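import Summits.RiemannHypothesis.RiemannHypothesis.Theorems.PfPersistenceDefectiveTransportShapeSector
import Summits.RiemannHypothesis.RiemannHypothesis.Theorems.SoloInformedNonDegenerate
import HarnessLib

/-!
# PF persistence campaign (cell `pub-rhpf`, leaf G1.22 TRANSPORT-1, gen 10): the transport kernel of
record, part 10 — THE INTEGRABLE-RATE FACE

Honest framing (verbatim, applies to every line): mechanism/rigidity campaign; no RH claims.

The leaf's brief (payload (ii), verbatim): "find a quantity `Q(a)` … satisfying a Grönwall-type
differential inequality `Q′ ≥ −κ(a) Q` with `κ` INTEGRABLE, seeded `Q(a₀) > 0` from the proved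
region ⇒ `Q(a) > 0` for all `a` ⇒ (what does `Q > 0` give?)".  Parts 1–9 read "integrable" as
"locally integrable" (a rate bounded on compact ranges) and classified those transports on the
floor-rate ladder.  This part takes the word LITERALLY.  An integrable rate delivers MORE than
`Q > 0`: the integrated form `Q(a) ≥ Q(a₀)·exp(−∫_{a₀}^{a} κ)` with `∫_{a₀}^{∞} κ < ∞` makes `Q`
UNIFORMLY positive on `[a₀, ∞)` (§1).  What uniform eventual positivity of `Q` gives is then decided
by what `Q` is dominated by, RH-free throughout (`ε = weilGroundEnergy`, `ε_ev`, `ε_od` the sector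
bottoms of `Literature.NumberTheory.LFunctions`):

* §2 `Q ≤ C·ε`, `Q ≤ C·ε_ev` or `Q ≤ C·ε_od` eventually (`C ≥ 0`; this covers `Q = ε`, the sector
  bottoms, `min`/`max` of sectors, and every `Q` that vanishes with the bottom): uniform positivity
  is IMPOSSIBLE, unconditionally — the even theta-quasimode ceiling `ε_ev ≤ exp(−e^{2a})`
  (`PolarPerronFrobenius.weilEvenGroundEnergy_le_exp_neg_mul_exp`) and the odd ceiling
  `limsup ε_od ≤ 0` (`OddSector.weilOddGroundEnergy_eventually_le`) send every such `Q` below any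
  positive level.  So the literal programme has NO member of this kind, sub-RH or not.
* §3 `Q ≤ C·(ε_od − ε_ev)` eventually (the PF-persistence splitting of candidate T-P and everything
  it dominates): uniform positivity REFUTES RH (Ω-form) — under RH both sector bottoms lie in
  `[0, δ]` eventually for every `δ > 0`, so the splitting dies.  In particular an integrable-rate
  Grönwall transport of the parity splitting from ANY positive seed (e.g. the PROVED one at
  `a₀ ≤ 2/3`) would be a DISPROOF of RH: the rate of any true transport law for the splitting is
  non-integrable by necessity, not by accident (DATA: `−Q′/Q ≈ 8πe^{2a} − 13.5`, TRANSPORT.md L1).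
* §4 the two classes that survive the word "integrable" are the ones parts 4–7 already placed:
  multiplicative GAUGES `Q = G·ε`, `G > 0` (positivity of `Q` on a half-line is RH itself, whatever
  the rate — `gaugePos_iff_riemannHypothesis`), and ADDITIVE DEFECTS `Q = ε + D` (uniform
  positivity = a floor `−D ≤ ε`, i.e. the defective face: floor rate `δ` ⟹ strip `δ/2`).

Every transport clause below is a HYPOTHESIS asserted of no real quantity; every conclusion is
either `False`, `¬ RiemannHypothesis` from that hypothesis, or a restatement on the floor-rate
ladder; nothing here is a step toward RH and no reach number is produced.

Statement index (numbering continues parts 1–9b, (1)–(64)): (65) `uniformPos_of_expTransport`,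
(66) `intervalIntegral_le_setIntegral_Ici`, (67) `uniformPos_of_integrableRate`,
(68) `weilEvenGroundEnergy_eventually_lt`, (69) `weilOddGroundEnergy_eventually_lt`,
(70) `weilGroundEnergy_eventually_lt`, (71) `maxSector_eventually_lt`,
(72) `not_uniformPos_of_le_mul`, (73) `not_uniformPos_of_le_weilGroundEnergy`,
(74) `…_le_weilEvenGroundEnergy`, (75) `…_le_weilOddGroundEnergy`, (76) `…_le_maxSector`,
(77) `not_integrableRate_transport_of_le_weilGroundEnergy`,
(78) `weilGroundEnergy_not_integrableRate_transport`,
(79) `splitting_eventually_lt_of_riemannHypothesis`,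
(80) `abs_splitting_eventually_lt_of_riemannHypothesis`,
(81) `not_riemannHypothesis_of_splitting_uniformPos`,
(82) `not_riemannHypothesis_of_uniformPos_of_le_splitting`,
(83) `not_riemannHypothesis_of_integrableRate_splittingTransport`,
(84) `splitting_not_integrableRate_transport_of_riemannHypothesis`,
(85) `not_riemannHypothesis_of_uniformPos_of_le_abs_splitting`,
(86) `not_riemannHypothesis_of_integrableRate_transport_of_le_abs_splitting`,
(87) `gaugePos_iff_riemannHypothesis`, (88) `floor_of_defectGauge_uniformPos`,
(89) `quasiRiemannHypothesis_of_defectGauge_uniformPos`.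

References: E. Bombieri, Rend. Mat. Acc. Lincei (9) 11 (2000) §4 (window monotonicity);
H. Yoshida, Adv. Stud. Pure Math. 21 (1992) Prop. 1 (odd positivity under RH); A. Connes,
C. Consani, H. Moscovici, arXiv:2511.22755 §3, §8; T. H. Grönwall, Ann. of Math. 20 (1919) 292–296
[folklore form of the integral inequality].
-/

noncomputable section

set_option linter.dupNamespace false

namespace Summit.RiemannHypothesis.RiemannHypothesis.Theorems.PfPersistenceDefectiveTransport

open Set Filter MeasureTheory
open _root_.Literature.NumberTheory.LFunctions
open _root_.Summit.RiemannHypothesis.RiemannHypothesis.Theorems.PolarPerronFrobenius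
  (weilEvenGroundEnergy_le_exp_neg_mul_exp)
open _root_.Summit.RiemannHypothesis.RiemannHypothesis.Theorems.OddSector
  (weilOddGroundEnergy_eventually_le)
open _root_.Summit.RiemannHypothesis.RiemannHypothesis.Theorems.PfPersistenceFloorRateDichotomy
  (riemannHypothesis_of_weilEvenGroundEnergy_bddBelow quasiRiemannHypothesis_of_floor)

/-! ## §1 What an integrable rate delivers: UNIFORM positivity -/

/-- **Grönwall with a bounded integrated rate = uniform positivity.**  If `Q(a) ≥ Q(a₀)·e^{−I(a)}`
on `[a₀, ∞)` with `I ≤ M` there and `Q(a₀) > 0`, then `Q ≥ Q(a₀)·e^{−M} > 0` on `[a₀, ∞)`.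
RH-free. [folklore] -/
theorem uniformPos_of_expTransport {Q I : ℝ → ℝ} {a₀ M : ℝ} (hseed : 0 < Q a₀)
    (hI : ∀ a : ℝ, a₀ ≤ a → I a ≤ M)
    (hT : ∀ a : ℝ, a₀ ≤ a → Q a₀ * Real.exp (-(I a)) ≤ Q a) :
    ∀ a : ℝ, a₀ ≤ a → Q a₀ * Real.exp (-M) ≤ Q a := by
  intro a ha
  have h1 : Real.exp (-M) ≤ Real.exp (-(I a)) := Real.exp_le_exp.2 (by linarith [hI a ha])
  exact (mul_le_mul_of_nonneg_left h1 hseed.le).trans (hT a ha)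

/-- For a rate `κ ≥ 0` integrable on `[a₀, ∞)`, every partial integral `∫_{a₀}^{a} κ` is bounded by
the total `∫_{[a₀, ∞)} κ`. RH-free. [folklore] -/
theorem intervalIntegral_le_setIntegral_Ici {κ : ℝ → ℝ} {a₀ a : ℝ} (ha : a₀ ≤ a)
    (hint : IntegrableOn κ (Ici a₀)) (hnn : ∀ x : ℝ, a₀ ≤ x → 0 ≤ κ x) :
    ∫ x in a₀..a, κ x ≤ ∫ x in Ici a₀, κ x := by
  rw [intervalIntegral.integral_of_le ha]
  refine setIntegral_mono_set hint ?_ ?_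
  · exact (ae_restrict_iff' measurableSet_Ici).2 (ae_of_all _ fun x hx => hnn x hx)
  · exact (Ioc_subset_Ioi_self.trans Ioi_subset_Ici_self).eventuallyLE

/-- **The literal Grönwall programme with an INTEGRABLE rate makes `Q` uniformly positive**: seed
`Q(a₀) > 0`, rate `κ ≥ 0` integrable on `[a₀, ∞)`, transport `Q(a) ≥ Q(a₀) exp(−∫_{a₀}^{a} κ)`
⟹ `∃ m > 0, Q ≥ m` on `[a₀, ∞)`.  RH-free. [folklore] -/
theorem uniformPos_of_integrableRate {Q κ : ℝ → ℝ} {a₀ : ℝ} (hseed : 0 < Q a₀)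
    (hint : IntegrableOn κ (Ici a₀)) (hnn : ∀ x : ℝ, a₀ ≤ x → 0 ≤ κ x)
    (hT : ∀ a : ℝ, a₀ ≤ a → Q a₀ * Real.exp (-(∫ x in a₀..a, κ x)) ≤ Q a) :
    ∃ m : ℝ, 0 < m ∧ ∀ a : ℝ, a₀ ≤ a → m ≤ Q a :=
  ⟨Q a₀ * Real.exp (-(∫ x in Ici a₀, κ x)), mul_pos hseed (Real.exp_pos _),
    uniformPos_of_expTransport (I := fun a => ∫ x in a₀..a, κ x) hseed
      (fun _ ha => intervalIntegral_le_setIntegral_Ici ha hint hnn) hT⟩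

/-! ## §2 `ε`-dominated quantities: uniform positivity is impossible (RH-free) -/

/-- The even bottom sinks below every positive level (theta-quasimode ceiling). RH-free.
[folklore] -/
theorem weilEvenGroundEnergy_eventually_lt {m : ℝ} (hm : 0 < m) :
    ∃ a₁ : ℝ, ∀ a : ℝ, a₁ ≤ a → weilEvenGroundEnergy a < m := by
  obtain ⟨a₀, ha₀⟩ := weilEvenGroundEnergy_le_exp_neg_mul_exp (c := 1)
    (by linarith [Real.pi_gt_three])
  refine ⟨max a₀ (|Real.log m| + 1), fun a ha => ?_⟩
  have ha1 : a₀ ≤ a := (le_max_left _ _).trans ha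
  have ha3 : |Real.log m| + 1 ≤ a := (le_max_right _ _).trans ha
  have h1 : weilEvenGroundEnergy a ≤ Real.exp (-(1 * Real.exp (2 * a))) := ha₀ a ha1
  have h2 : -(1 * Real.exp (2 * a)) < Real.log m := by
    have h3 : 2 * a + 1 ≤ Real.exp (2 * a) := Real.add_one_le_exp _
    have h4 : -Real.log m ≤ |Real.log m| := neg_le_abs _
    have h4' : Real.log m ≤ |Real.log m| := le_abs_self _
    linarith
  have h5 : Real.exp (-(1 * Real.exp (2 * a))) < m := by
    calc Real.exp (-(1 * Real.exp (2 * a))) < Real.exp (Real.log m) := Real.exp_lt_exp.2 h2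
      _ = m := Real.exp_log hm
  linarith

/-- The odd bottom sinks below every positive level (`limsup ε_od ≤ 0`). RH-free. [folklore] -/
theorem weilOddGroundEnergy_eventually_lt {m : ℝ} (hm : 0 < m) :
    ∃ a₁ : ℝ, ∀ a : ℝ, a₁ ≤ a → weilOddGroundEnergy a < m := by
  obtain ⟨a₁, ha₁⟩ := Filter.eventually_atTop.1
    (weilOddGroundEnergy_eventually_le (δ := m / 2) (by linarith))
  exact ⟨a₁, fun a ha => by linarith [ha₁ a ha]⟩

/-- The parity-free bottom sinks below every positive level (`ε ≤ ε_od`). RH-free. [folklore] -/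
theorem weilGroundEnergy_eventually_lt {m : ℝ} (hm : 0 < m) :
    ∃ a₁ : ℝ, ∀ a : ℝ, a₁ ≤ a → weilGroundEnergy a < m := by
  obtain ⟨a₁, ha₁⟩ := weilOddGroundEnergy_eventually_lt hm
  exact ⟨a₁, fun a ha => (weilGroundEnergy_le_weilOddGroundEnergy a).trans_lt (ha₁ a ha)⟩

/-- Even the LARGER sector bottom `max ε_ev ε_od` sinks below every positive level. RH-free.
[folklore] -/
theorem maxSector_eventually_lt {m : ℝ} (hm : 0 < m) :
    ∃ a₁ : ℝ, ∀ a : ℝ, a₁ ≤ a → max (weilEvenGroundEnergy a) (weilOddGroundEnergy a) < m := by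
  obtain ⟨a₁, ha₁⟩ := weilEvenGroundEnergy_eventually_lt hm
  obtain ⟨a₂, ha₂⟩ := weilOddGroundEnergy_eventually_lt hm
  exact ⟨max a₁ a₂, fun a ha =>
    max_lt (ha₁ a ((le_max_left _ _).trans ha)) (ha₂ a ((le_max_right _ _).trans ha))⟩

/-- Abstract step: a quantity dominated by `C·f` (`C ≥ 0`) with `f` sinking below every positive
level is not uniformly positive on any half-line. RH-free. [folklore] -/
theorem not_uniformPos_of_le_mul {Q f : ℝ → ℝ} {C a₁ : ℝ} (hC : 0 ≤ C)
    (hdom : ∀ a : ℝ, a₁ ≤ a → Q a ≤ C * f a)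
    (hsink : ∀ m : ℝ, 0 < m → ∃ a₂ : ℝ, ∀ a : ℝ, a₂ ≤ a → f a < m) :
    ¬ ∃ m a₀ : ℝ, 0 < m ∧ ∀ a : ℝ, a₀ ≤ a → m ≤ Q a := by
  rintro ⟨m, a₀, hm, h⟩
  obtain ⟨a₂, ha₂⟩ := hsink (m / (C + 1)) (div_pos hm (by linarith))
  set a : ℝ := max a₀ (max a₁ a₂) with ha
  have h0 : m ≤ Q a := h a (le_max_left _ _)
  have h1 : Q a ≤ C * f a := hdom a ((le_max_left _ _).trans (le_max_right _ _))
  have h2 : f a < m / (C + 1) := ha₂ a ((le_max_right _ _).trans (le_max_right _ _))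
  rcases le_or_gt (f a) 0 with hf | hf
  · have : C * f a ≤ 0 := mul_nonpos_of_nonneg_of_nonpos hC hf
    linarith
  · have h3 : C * f a ≤ C * (m / (C + 1)) := mul_le_mul_of_nonneg_left h2.le hC
    have h4 : C * (m / (C + 1)) < m := by
      rw [mul_div_assoc']
      rw [div_lt_iff₀ (by linarith : (0:ℝ) < C + 1)]
      nlinarith
    linarith

/-- **No `ε`-dominated quantity is uniformly positive** (`Q ≤ C·ε` beyond `a₁`, `C ≥ 0`).
UNCONDITIONAL. [folklore] -/
theorem not_uniformPos_of_le_weilGroundEnergy {Q : ℝ → ℝ} {C a₁ : ℝ} (hC : 0 ≤ C)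
    (hdom : ∀ a : ℝ, a₁ ≤ a → Q a ≤ C * weilGroundEnergy a) :
    ¬ ∃ m a₀ : ℝ, 0 < m ∧ ∀ a : ℝ, a₀ ≤ a → m ≤ Q a :=
  not_uniformPos_of_le_mul hC hdom fun _ hm => weilGroundEnergy_eventually_lt hm

/-- Even-sector twin: no `ε_ev`-dominated quantity is uniformly positive. UNCONDITIONAL.
[folklore] -/
theorem not_uniformPos_of_le_weilEvenGroundEnergy {Q : ℝ → ℝ} {C a₁ : ℝ} (hC : 0 ≤ C)
    (hdom : ∀ a : ℝ, a₁ ≤ a → Q a ≤ C * weilEvenGroundEnergy a) :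
    ¬ ∃ m a₀ : ℝ, 0 < m ∧ ∀ a : ℝ, a₀ ≤ a → m ≤ Q a :=
  not_uniformPos_of_le_mul hC hdom fun _ hm => weilEvenGroundEnergy_eventually_lt hm

/-- Odd-sector twin: no `ε_od`-dominated quantity is uniformly positive. UNCONDITIONAL.
[folklore] -/
theorem not_uniformPos_of_le_weilOddGroundEnergy {Q : ℝ → ℝ} {C a₁ : ℝ} (hC : 0 ≤ C)
    (hdom : ∀ a : ℝ, a₁ ≤ a → Q a ≤ C * weilOddGroundEnergy a) :
    ¬ ∃ m a₀ : ℝ, 0 < m ∧ ∀ a : ℝ, a₀ ≤ a → m ≤ Q a :=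
  not_uniformPos_of_le_mul hC hdom fun _ hm => weilOddGroundEnergy_eventually_lt hm

/-- No quantity dominated by the LARGER sector bottom (`Q ≤ C·max ε_ev ε_od`, so in particular
`min`, `max`, convex combinations and products of sector data vanishing with them) is uniformly
positive. UNCONDITIONAL. [folklore] -/
theorem not_uniformPos_of_le_maxSector {Q : ℝ → ℝ} {C a₁ : ℝ} (hC : 0 ≤ C)
    (hdom : ∀ a : ℝ, a₁ ≤ a →
      Q a ≤ C * max (weilEvenGroundEnergy a) (weilOddGroundEnergy a)) :
    ¬ ∃ m a₀ : ℝ, 0 < m ∧ ∀ a : ℝ, a₀ ≤ a → m ≤ Q a :=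
  not_uniformPos_of_le_mul hC hdom fun _ hm => maxSector_eventually_lt hm

/-- **THE LITERAL PROGRAMME IS EMPTY FOR `ε`-DOMINATED `Q`.**  Seed `Q(a₀) > 0`, rate `κ ≥ 0`
INTEGRABLE on `[a₀, ∞)`, the Grönwall conclusion `Q(a) ≥ Q(a₀) exp(−∫_{a₀}^{a} κ)`, and
`Q ≤ C·ε` eventually (`C ≥ 0`) are contradictory — UNCONDITIONALLY (no RH either way).  With
`Q = ε`, `C = 1` this is the payload's programme verbatim; a locally-integrable rate instead is
RH itself (parts 1, 7: `leakage_anyBase_iff_riemannHypothesis`). [folklore] -/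
theorem not_integrableRate_transport_of_le_weilGroundEnergy {Q κ : ℝ → ℝ} {a₀ a₁ C : ℝ}
    (hseed : 0 < Q a₀) (hint : IntegrableOn κ (Ici a₀)) (hnn : ∀ x : ℝ, a₀ ≤ x → 0 ≤ κ x)
    (hC : 0 ≤ C) (hdom : ∀ a : ℝ, a₁ ≤ a → Q a ≤ C * weilGroundEnergy a) :
    ¬ ∀ a : ℝ, a₀ ≤ a → Q a₀ * Real.exp (-(∫ x in a₀..a, κ x)) ≤ Q a := by
  intro hT
  obtain ⟨m, hm, h⟩ := uniformPos_of_integrableRate hseed hint hnn hT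
  exact not_uniformPos_of_le_weilGroundEnergy hC hdom ⟨m, a₀, hm, h⟩

/-- The same for the full bottom itself: `ε` admits NO integrable-rate Grönwall transport from any
positive seed — UNCONDITIONAL (compare: a locally bounded rate from any base ⟺ RH, part 7a).
[folklore] -/
theorem weilGroundEnergy_not_integrableRate_transport {κ : ℝ → ℝ} {a₀ : ℝ}
    (hseed : 0 < weilGroundEnergy a₀) (hint : IntegrableOn κ (Ici a₀))
    (hnn : ∀ x : ℝ, a₀ ≤ x → 0 ≤ κ x) :
    ¬ ∀ a : ℝ, a₀ ≤ a →
      weilGroundEnergy a₀ * Real.exp (-(∫ x in a₀..a, κ x)) ≤ weilGroundEnergy a :=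
  not_integrableRate_transport_of_le_weilGroundEnergy (C := 1) (a₁ := a₀) hseed hint hnn
    zero_le_one fun a _ => by rw [one_mul]

/-! ## §3 Splitting-dominated quantities: uniform positivity refutes RH (Ω-form) -/

/-- Under RH the parity splitting dies: `ε_od − ε_ev < m` beyond some window, for every `m > 0`
(`0 ≤ ε ≤ ε_ev` under RH and `limsup ε_od ≤ 0`).  proof.conditional (RH is the hypothesis);
no RH claim. [folklore] -/
theorem splitting_eventually_lt_of_riemannHypothesis (hRH : _root_.RiemannHypothesis) {m : ℝ}
    (hm : 0 < m) :
    ∃ a₁ : ℝ, ∀ a : ℝ, a₁ ≤ a → weilOddGroundEnergy a - weilEvenGroundEnergy a < m := by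
  obtain ⟨a₁, ha₁⟩ := weilOddGroundEnergy_eventually_lt hm
  refine ⟨max a₁ 1, fun a ha => ?_⟩
  have ha0 : 0 < a := by linarith [le_max_right a₁ 1]
  have hev : 0 ≤ weilEvenGroundEnergy a :=
    (weilGroundEnergy_nonneg_of_riemannHypothesis hRH ha0).trans
      (weilGroundEnergy_le_weilEvenGroundEnergy a)
  linarith [ha₁ a ((le_max_left _ _).trans ha)]

/-- Under RH the splitting dies in absolute value: `|ε_od − ε_ev| < m` eventually (both sector
bottoms lie in `[0, m)` eventually).  proof.conditional; no RH claim. [folklore] -/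
theorem abs_splitting_eventually_lt_of_riemannHypothesis (hRH : _root_.RiemannHypothesis) {m : ℝ}
    (hm : 0 < m) :
    ∃ a₁ : ℝ, ∀ a : ℝ, a₁ ≤ a → |weilOddGroundEnergy a - weilEvenGroundEnergy a| < m := by
  obtain ⟨a₁, ha₁⟩ := weilOddGroundEnergy_eventually_lt hm
  obtain ⟨a₂, ha₂⟩ := weilEvenGroundEnergy_eventually_lt hm
  refine ⟨max (max a₁ a₂) 1, fun a ha => ?_⟩
  have ha0 : 0 < a := by linarith [le_max_right (max a₁ a₂) 1]
  have h0 : 0 ≤ weilGroundEnergy a := weilGroundEnergy_nonneg_of_riemannHypothesis hRH ha0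
  have hev : 0 ≤ weilEvenGroundEnergy a := h0.trans (weilGroundEnergy_le_weilEvenGroundEnergy a)
  have hod : 0 ≤ weilOddGroundEnergy a := h0.trans (weilGroundEnergy_le_weilOddGroundEnergy a)
  have h1 := ha₁ a ((le_max_left _ _).trans ((le_max_left _ _).trans ha))
  have h2 := ha₂ a ((le_max_right _ _).trans ((le_max_left _ _).trans ha))
  rw [abs_lt]
  constructor <;> linarith

/-- **Uniform positivity of the parity splitting refutes RH** (Ω-form; the hypothesis is asserted
of nothing).  proof.conditional; no RH claim. [folklore] -/
theorem not_riemannHypothesis_of_splitting_uniformPos {m a₀ : ℝ} (hm : 0 < m)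
    (h : ∀ a : ℝ, a₀ ≤ a → m ≤ weilOddGroundEnergy a - weilEvenGroundEnergy a) :
    ¬ _root_.RiemannHypothesis := by
  intro hRH
  obtain ⟨a₁, ha₁⟩ := splitting_eventually_lt_of_riemannHypothesis hRH hm
  have h1 := h (max a₀ a₁) (le_max_left _ _)
  have h2 := ha₁ (max a₀ a₁) (le_max_right _ _)
  linarith

/-- **Uniform positivity of any splitting-dominated quantity refutes RH** (`Q ≤ C·(ε_od − ε_ev)`
beyond `a₁`, `C ≥ 0`).  Ω-form; proof.conditional; no RH claim. [folklore] -/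
theorem not_riemannHypothesis_of_uniformPos_of_le_splitting {Q : ℝ → ℝ} {C a₁ m a₀ : ℝ}
    (hC : 0 ≤ C)
    (hdom : ∀ a : ℝ, a₁ ≤ a → Q a ≤ C * (weilOddGroundEnergy a - weilEvenGroundEnergy a))
    (hm : 0 < m) (h : ∀ a : ℝ, a₀ ≤ a → m ≤ Q a) : ¬ _root_.RiemannHypothesis := by
  intro hRH
  exact not_uniformPos_of_le_mul hC hdom
    (fun m' hm' => splitting_eventually_lt_of_riemannHypothesis hRH hm') ⟨m, a₀, hm, h⟩

/-- **AN INTEGRABLE-RATE TRANSPORT OF PF PERSISTENCE WOULD DISPROVE RH.**  If the parity splitting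
`Q = ε_od − ε_ev` obeyed the Grönwall conclusion `Q(a) ≥ Q(a₀) exp(−∫_{a₀}^{a} κ)` from a positive
seed (the PROVED frontier gives one at every `0 < a₀ ≤ 2/3`) with a rate `κ ≥ 0` INTEGRABLE on
`[a₀, ∞)`, RH would be false.  Hence every transport law for the splitting that is compatible with
RH has a NON-integrable rate (candidate T-P's sharp member `κ = 8πe^{2a} − m⁻` is of that kind).
Ω-form; the transport clause is asserted of nothing; no RH claim either way. [folklore] -/
theorem not_riemannHypothesis_of_integrableRate_splittingTransport {κ : ℝ → ℝ} {a₀ : ℝ}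
    (hseed : 0 < weilOddGroundEnergy a₀ - weilEvenGroundEnergy a₀)
    (hint : IntegrableOn κ (Ici a₀)) (hnn : ∀ x : ℝ, a₀ ≤ x → 0 ≤ κ x)
    (hT : ∀ a : ℝ, a₀ ≤ a →
      (weilOddGroundEnergy a₀ - weilEvenGroundEnergy a₀) * Real.exp (-(∫ x in a₀..a, κ x)) ≤
        weilOddGroundEnergy a - weilEvenGroundEnergy a) :
    ¬ _root_.RiemannHypothesis := by
  obtain ⟨m, hm, h⟩ := uniformPos_of_integrableRate
    (Q := fun a => weilOddGroundEnergy a - weilEvenGroundEnergy a) hseed hint hnn hT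
  exact not_riemannHypothesis_of_splitting_uniformPos hm h

/-- Contrapositive, for the record: under RH the parity splitting admits NO integrable-rate
transport from any positive seed (its total leakage `∫κ` diverges).  proof.conditional; no RH
claim. [folklore] -/
theorem splitting_not_integrableRate_transport_of_riemannHypothesis
    (hRH : _root_.RiemannHypothesis) {κ : ℝ → ℝ} {a₀ : ℝ}
    (hseed : 0 < weilOddGroundEnergy a₀ - weilEvenGroundEnergy a₀)
    (hint : IntegrableOn κ (Ici a₀)) (hnn : ∀ x : ℝ, a₀ ≤ x → 0 ≤ κ x) :
    ¬ ∀ a : ℝ, a₀ ≤ a →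
      (weilOddGroundEnergy a₀ - weilEvenGroundEnergy a₀) * Real.exp (-(∫ x in a₀..a, κ x)) ≤
        weilOddGroundEnergy a - weilEvenGroundEnergy a :=
  fun hT => not_riemannHypothesis_of_integrableRate_splittingTransport hseed hint hnn hT hRH

/-- **Uniform positivity of any `|ε_od − ε_ev|`-dominated quantity refutes RH** — this covers the
spectral GAP `ε₂ − ε₁` of the window form whenever `ε₂ ≤ max ε_ev ε_od` (min–max over the two
parity sectors; an informal remark, the gap is not a tree object), and every unsigned splitting
functional.  Ω-form; proof.conditional; no RH claim. [folklore] -/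
theorem not_riemannHypothesis_of_uniformPos_of_le_abs_splitting {Q : ℝ → ℝ} {C a₁ m a₀ : ℝ}
    (hC : 0 ≤ C)
    (hdom : ∀ a : ℝ, a₁ ≤ a → Q a ≤ C * |weilOddGroundEnergy a - weilEvenGroundEnergy a|)
    (hm : 0 < m) (h : ∀ a : ℝ, a₀ ≤ a → m ≤ Q a) : ¬ _root_.RiemannHypothesis := by
  intro hRH
  exact not_uniformPos_of_le_mul hC hdom
    (fun m' hm' => abs_splitting_eventually_lt_of_riemannHypothesis hRH hm') ⟨m, a₀, hm, h⟩

/-- **General form: an integrable-rate Grönwall transport, from a positive seed, of ANY quantity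
dominated by the unsigned splitting would disprove RH** (`Q ≤ C·|ε_od − ε_ev|` beyond `a₁`,
`C ≥ 0`; `κ ≥ 0` integrable on `[a₀, ∞)`).  Ω-form; the transport clause is asserted of
nothing; no RH claim either way. [folklore] -/
theorem not_riemannHypothesis_of_integrableRate_transport_of_le_abs_splitting {Q κ : ℝ → ℝ}
    {a₀ a₁ C : ℝ} (hseed : 0 < Q a₀) (hint : IntegrableOn κ (Ici a₀))
    (hnn : ∀ x : ℝ, a₀ ≤ x → 0 ≤ κ x) (hC : 0 ≤ C)
    (hdom : ∀ a : ℝ, a₁ ≤ a → Q a ≤ C * |weilOddGroundEnergy a - weilEvenGroundEnergy a|)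
    (hT : ∀ a : ℝ, a₀ ≤ a → Q a₀ * Real.exp (-(∫ x in a₀..a, κ x)) ≤ Q a) :
    ¬ _root_.RiemannHypothesis := by
  obtain ⟨m, hm, h⟩ := uniformPos_of_integrableRate hseed hint hnn hT
  exact not_riemannHypothesis_of_uniformPos_of_le_abs_splitting hC hdom hm h

/-! ## §4 What survives the word "integrable": gauges (≡ RH) and defects (the floor-rate ladder) -/

/-- **Positivity of a multiplicative gauge `G·ε` (`G > 0`) on a half-line `[a₀, ∞)`, `a₀ > 0`, IS
RH** — whatever rate transported it (`→`: `ε > 0` there is an even-sector floor `0`, hence RH,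
`riemannHypothesis_of_weilEvenGroundEnergy_bddBelow`; `←`: `ε > 0` at every window under RH,
`weilGroundEnergy_pos_of_riemannHypothesis`).  proof.conditional both ways; credits nothing; no
RH claim. [folklore] -/
theorem gaugePos_iff_riemannHypothesis {G : ℝ → ℝ} {a₀ : ℝ} (ha₀ : 0 < a₀)
    (hG : ∀ a : ℝ, a₀ ≤ a → 0 < G a) :
    (∀ a : ℝ, a₀ ≤ a → 0 < G a * weilGroundEnergy a) ↔ _root_.RiemannHypothesis := by
  constructor
  · intro h
    refine riemannHypothesis_of_weilEvenGroundEnergy_bddBelow (L := 0) (a₀ := a₀) fun a ha => ?_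
    have h1 : 0 < weilGroundEnergy a := pos_of_mul_pos_right (h a ha) (hG a ha).le
    exact h1.le.trans (weilGroundEnergy_le_weilEvenGroundEnergy a)
  · intro hRH a ha
    exact mul_pos (hG a ha) (weilGroundEnergy_pos_of_riemannHypothesis hRH (ha₀.trans_le ha))

/-- **Uniform positivity of an additive-defect gauge `ε + D` is a FLOOR `−(D − m) ≤ ε`** — the
defective face of parts 1–7 (nothing else): with `D(a) = K e^{δ a}` it is a floor of rate `δ`,
hence the strip `|Re ρ − 1/2| ≤ δ/2` / `QuasiRiemannHypothesis (1/2 + δ/2)` (next theorem).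
RH-free rewriting. [folklore] -/
theorem floor_of_defectGauge_uniformPos {D : ℝ → ℝ} {m a₀ : ℝ}
    (h : ∀ a : ℝ, a₀ ≤ a → m ≤ weilGroundEnergy a + D a) :
    ∀ a : ℝ, a₀ ≤ a → -(D a - m) ≤ weilGroundEnergy a := fun a ha => by linarith [h a ha]

/-- The exponential instance: uniform positivity of `ε + K e^{δa}` on `[a₀, ∞)` (`δ ≥ 0`, any
`m ≥ 0`) gives `QuasiRiemannHypothesis (1/2 + δ/2)` — exactly part 4's dictionary; the integrable
rate added nothing.  proof.conditional; no RH claim. [folklore] -/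
theorem quasiRiemannHypothesis_of_defectGauge_uniformPos {K δ m a₀ : ℝ} (hδ : 0 ≤ δ) (hm : 0 ≤ m)
    (h : ∀ a : ℝ, a₀ ≤ a → m ≤ weilGroundEnergy a + K * Real.exp (δ * a)) :
    QuasiRiemannHypothesis (1 / 2 + δ / 2) :=
  quasiRiemannHypothesis_of_floor (K := K) (a₀ := a₀) hδ fun a ha => by linarith [h a ha]

end Summit.RiemannHypothesis.RiemannHypothesis.Theorems.PfPersistenceDefectiveTransport

end
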